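import Literature.AlgebraicGeometry.HodgeTheory.HodgeIndexTheoremLatticeSignature
import HarnessLib

/-!
# The Hodge index theorem and the Hodge–Riemann relation for a POSITIVE orientation of `X(ℂ)`

Family `hodge`, layer `Literature/AlgebraicGeometry/HodgeTheory`. Theorems only (no definition, no
named fact; D-0026). The tree's signed Hodge index theorem (`hodgeIndex_hodgeRiemann_even`,
`hodgeIndex_intersectionForm_signature`) is stated for an ARBITRARY `ℤ`-orientation `μ` of the
closed `4m`-manifold `X(ℂ)` with an orientation sign `ε = ±1` (the complex orientation of
`Motives/ComplexPointsOrientation` is a `Classical.choice`, so its sign is not decidable in the tree).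
This file removes the sign the way the printed theorem is used: **there is an orientation `μ` of
`X(ℂ)` — unique up to the involution `μ ↦ -μ`, which exhausts all orientations of the connected
manifold `X(ℂ)` — for which `ε = +1`**, i.e. simultaneously

* (Hodge index, Voisin I Thm. 6.33 / Hirzebruch Thm. 15.8.2 / Huybrechts Cor. 3.3.18)
  `τ(X(ℂ), μ) = Σ_{a,b ≤ 2m} (-1)^a h^{a,b}(X)` on the integral intersection lattice
  `H^{2m}(X(ℂ); ℤ)/T` and `b⁺ − b⁻ = Σ_{a,b} (-1)^a h^{a,b}(X)` for the real cup form
  `x ↦ ⟨x ⌣ x, [X(ℂ)]_μ ⊗ 1⟩` on `H^{2m}(X(ℂ); ℝ)`;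
* (Hodge–Riemann, Voisin I Thm. 6.32 in bidegree `(m, m)`, `r = 0`)
  `(-1)^m ⟨x ⌣ x, [X(ℂ)]_μ ⊗ 1⟩ > 0` for every non-zero real primitive class `x` of type `(m, m)`.

Proof: take any orientation `μ₀` (`Motives.ComplexPoints.isOrientableOver`); if its sign is `-1`,
replace it by `-μ₀`: `[X]_{-μ₀} = -[X]_{μ₀}` (`HomologicalOrientation.fundamentalClass_neg_holds`)
negates the form, swaps `b⁺ ↔ b⁻` and negates `τ` (`signature_intersectionForm_neg_holds`); every
orientation of the connected `X(ℂ)` is `±μ` (`HomologicalOrientation.eq_or_eq_neg_of_connected_holds`).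

## References

* [VoisinHodgeI2002] C. Voisin, Hodge Theory and Complex Algebraic Geometry I (2002), §6.3.2
  Thms. 6.32–6.33.
* [Hirzebruch1966] F. Hirzebruch, Topological Methods in Algebraic Geometry (1966), §15.8 Thm. 15.8.2.
* [HuybrechtsCG2005] D. Huybrechts, Complex Geometry (2005), §3.3 Cor. 3.3.18.
* [HatcherAT2002] A. Hatcher, Algebraic Topology (2002), §3.3 p. 236 (`[X]_{-μ} = -[X]_μ`).
-/

noncomputable section

open scoped Manifold ContDiff
open CategoryTheory AlgebraicGeometry Module Bundle Finset
open Literature.AlgebraicTopology.SingularHomology Literature.Geometry.Kaehler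
open Literature.NumberTheory.Transcendental
open Literature.AlgebraicGeometry.Motives (IsSmoothProjective)

namespace Literature.AlgebraicGeometry.HodgeTheory

section Orientation

variable {m : ℕ} {X : Motives.SchemeOver ℂ}

/-- `b⁺(-Q) - b⁻(-Q) = -(b⁺(Q) - b⁻(Q))` (`b⁻(Q) = b⁺(-Q)` by definition). [folklore] -/
private theorem sigPos_neg_sub_sigNeg_neg' {V : Type*} [AddCommGroup V] [Module ℝ V]
    (Q : QuadraticForm ℝ V) : (sigPos (-Q) : ℤ) - sigNeg (-Q) = -((sigPos Q : ℤ) - sigNeg Q) := by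
  have h1 : sigPos (-Q) = sigNeg Q := rfl
  have h2 : sigNeg (-Q) = sigPos Q := by
    change sigPos (- -Q) = sigPos Q
    rw [neg_neg]
  rw [h1, h2]
  ring

/-- **The Hodge index theorem and the Hodge–Riemann relation for a positive orientation.** For `X`
smooth projective over `ℂ` of dimension `2m` (top degree spelled `N = 2·(2m) = 2m + 2m`) there is a
`ℤ`-orientation `μ` of the closed manifold `X(ℂ)` such that: every orientation of `X(ℂ)` is `μ` or
`-μ`; the integral intersection form on `H^{2m}(X(ℂ); ℤ)/T` has signature
`τ = Σ_{a,b ≤ 2m} (-1)^a h^{a,b}(X)` and the real cup form `x ↦ ⟨x ⌣ x, [X(ℂ)]_μ ⊗ 1⟩` on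
`H^{2m}(X(ℂ); ℝ)` has `b⁺ - b⁻ = Σ_{a,b} (-1)^a h^{a,b}(X)` (for every Hodge model); and
`(-1)^m ⟨x ⌣ x, [X(ℂ)]_μ ⊗ 1⟩ > 0` for every non-zero real class `x` of type `(m, m)` with
`e ⌣ x = 0` for all `e ∈ H²(X(ℂ); ℂ)` (primitive). (The printed theorems, for the complex
orientation; here `μ` is characterised by the sign.)
[cite: VoisinHodgeI2002, §6.3.2 Thm. 6.33 and Thm. 6.32] [cite: Hirzebruch1966, §15.8 Thm. 15.8.2]
[cite: HuybrechtsCG2005, §3.3 Cor. 3.3.18] -/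
theorem exists_orientation_hodgeIndex_hodgeRiemann (hX : IsSmoothProjective (2 * m) X) {N : ℕ}
    (hN : 2 * (2 * m) = N) (hdeg : 2 * m + 2 * m = N) :
    ∃ μ : HomologicalOrientation ℤ (Motives.ComplexPoints X) N,
      (∀ ν : HomologicalOrientation ℤ (Motives.ComplexPoints X) N, ν = μ ∨ ν = -μ) ∧
      (∀ A : HodgeModel (2 * m) X,
        (intersectionForm hdeg μ).signature =
          ∑ a : Fin (2 * m + 1), ∑ b : Fin (2 * m + 1),
            (-1 : ℤ) ^ (a : ℕ) * (Module.finrank ℂ (A.hodgePQ ((a : ℕ) + b) a b) : ℤ)) ∧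
      (∀ A : HodgeModel (2 * m) X,
        ((sigPos
            (LinearMap.BilinMap.toQuadraticMap
              ((cupProduct (R := ℝ) (X := Motives.ComplexPoints X) hdeg).compr₂
                ((kroneckerPairing ℝ ℝ (Motives.ComplexPoints X) N).flip
                  (singularHomology.coeffChange (Motives.ComplexPoints X)
                    (algebraMap ℤ ℝ : ℤ →+* ℝ).toAddMonoidHom N μ.fundamentalClass)))) : ℤ) -
          sigNeg
            (LinearMap.BilinMap.toQuadraticMap
              ((cupProduct (R := ℝ) (X := Motives.ComplexPoints X) hdeg).compr₂
                ((kroneckerPairing ℝ ℝ (Motives.ComplexPoints X) N).flip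
                  (singularHomology.coeffChange (Motives.ComplexPoints X)
                    (algebraMap ℤ ℝ : ℤ →+* ℝ).toAddMonoidHom N μ.fundamentalClass))))) =
          ∑ a : Fin (2 * m + 1), ∑ b : Fin (2 * m + 1),
            (-1 : ℤ) ^ (a : ℕ) * (Module.finrank ℂ (A.hodgePQ ((a : ℕ) + b) a b) : ℤ)) ∧
      (∀ x : singularCohomology ℝ ℝ (Motives.ComplexPoints X) (2 * m), x ≠ 0 →
        IsOfHodgeType (2 * m) X (2 * m) m m
          (singularCohomology.ringChange (algebraMap ℝ ℂ) (Motives.ComplexPoints X) (2 * m) x) →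
        (∀ e : singularCohomology ℂ ℂ (Motives.ComplexPoints X) 2,
          cupProduct (R := ℂ) (X := Motives.ComplexPoints X) (Nat.add_comm 2 (2 * m)) e
            (singularCohomology.ringChange (algebraMap ℝ ℂ) (Motives.ComplexPoints X) (2 * m) x) = 0) →
        (0 : ℝ) < (-1 : ℝ) ^ m *
          (cupProduct (R := ℝ) (X := Motives.ComplexPoints X) hdeg).compr₂
            ((kroneckerPairing ℝ ℝ (Motives.ComplexPoints X) N).flip
              (singularHomology.coeffChange (Motives.ComplexPoints X)
                (algebraMap ℤ ℝ : ℤ →+* ℝ).toAddMonoidHom N μ.fundamentalClass)) x x) := by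
  subst hN
  letI := hX.chartedSpace
  haveI := Motives.ComplexPoints.compactSpace_of_isSmoothProjective hX
  haveI := Motives.ComplexPoints.t2Space_of_isSmoothProjective hX
  haveI := connectedSpace_complexPoints hX
  obtain ⟨μ₀⟩ := Motives.ComplexPoints.isOrientableOver ℤ hX
  -- every orientation of the connected manifold `X(ℂ)` is `±μ₀`, hence `±μ` for `μ = ±μ₀`
  have hall : ∀ μ : HomologicalOrientation ℤ (Motives.ComplexPoints X) (2 * (2 * m)),
      (μ = μ₀ ∨ μ = -μ₀) →
        ∀ ν : HomologicalOrientation ℤ (Motives.ComplexPoints X) (2 * (2 * m)), ν = μ ∨ ν = -μ := by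
    rintro μ (rfl | rfl) ν
    · exact HomologicalOrientation.eq_or_eq_neg_of_connected_holds (Motives.ComplexPoints X) ν μ
    · rcases HomologicalOrientation.eq_or_eq_neg_of_connected_holds (Motives.ComplexPoints X) ν μ₀
        with h | h
      · exact Or.inr (by rw [h, neg_neg])
      · exact Or.inl h
  -- the lattice signature is the real `b⁺ - b⁻`
  have hlat : ∀ μ : HomologicalOrientation ℤ (Motives.ComplexPoints X) (2 * (2 * m)),
      (intersectionForm hdeg μ).signature =
        (sigPos (LinearMap.BilinMap.toQuadraticMap
            ((cupProduct (R := ℝ) (X := Motives.ComplexPoints X) hdeg).compr₂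
              ((kroneckerPairing ℝ ℝ (Motives.ComplexPoints X) (2 * (2 * m))).flip
                (singularHomology.coeffChange (Motives.ComplexPoints X)
                  (algebraMap ℤ ℝ : ℤ →+* ℝ).toAddMonoidHom (2 * (2 * m)) μ.fundamentalClass)))) : ℤ) -
          sigNeg (LinearMap.BilinMap.toQuadraticMap
            ((cupProduct (R := ℝ) (X := Motives.ComplexPoints X) hdeg).compr₂
              ((kroneckerPairing ℝ ℝ (Motives.ComplexPoints X) (2 * (2 * m))).flip
                (singularHomology.coeffChange (Motives.ComplexPoints X)
                  (algebraMap ℤ ℝ : ℤ →+* ℝ).toAddMonoidHom (2 * (2 * m)) μ.fundamentalClass)))) :=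
    fun μ ↦ Literature.Topology.FourManifolds.signature_intersectionForm_eq_real_compr₂
      (even_two_mul m) hdeg μ
  obtain ⟨ε, hε, hHI, hHR⟩ := hodgeIndex_hodgeRiemann_even hX rfl μ₀ hdeg
  rcases hε with rfl | rfl
  · -- `ε = 1`: `μ₀` itself
    refine ⟨μ₀, hall μ₀ (Or.inl rfl), fun A ↦ ?_, fun A ↦ ?_, fun x hx0 hxT hprim ↦ ?_⟩
    · rw [hlat μ₀, hHI A, one_mul]
    · rw [hHI A, one_mul]
    · have h := hHR x hx0 hxT hprim
      rwa [Int.cast_one, mul_one] at h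
  · -- `ε = -1`: the opposite orientation `-μ₀`
    have hB : ∀ x y : singularCohomology ℝ ℝ (Motives.ComplexPoints X) (2 * m),
        (cupProduct (R := ℝ) (X := Motives.ComplexPoints X) hdeg).compr₂
            ((kroneckerPairing ℝ ℝ (Motives.ComplexPoints X) (2 * (2 * m))).flip
              (singularHomology.coeffChange (Motives.ComplexPoints X)
                (algebraMap ℤ ℝ : ℤ →+* ℝ).toAddMonoidHom (2 * (2 * m)) (-μ₀).fundamentalClass)) x y =
          -(cupProduct (R := ℝ) (X := Motives.ComplexPoints X) hdeg).compr₂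
            ((kroneckerPairing ℝ ℝ (Motives.ComplexPoints X) (2 * (2 * m))).flip
              (singularHomology.coeffChange (Motives.ComplexPoints X)
                (algebraMap ℤ ℝ : ℤ →+* ℝ).toAddMonoidHom (2 * (2 * m)) μ₀.fundamentalClass)) x y := by
      intro x y
      rw [LinearMap.compr₂_apply, LinearMap.compr₂_apply, LinearMap.flip_apply, LinearMap.flip_apply,
        HomologicalOrientation.fundamentalClass_neg_holds (R := ℤ) (X := Motives.ComplexPoints X)
          (2 * (2 * m)) μ₀, map_neg, map_neg]
    have hQ := toQuadraticMap_cupPairing_neg hdeg μ₀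
    refine ⟨-μ₀, hall (-μ₀) (Or.inr rfl), fun A ↦ ?_, fun A ↦ ?_, fun x hx0 hxT hprim ↦ ?_⟩
    · rw [hlat (-μ₀), hQ, sigPos_neg_sub_sigNeg_neg', hHI A]
      ring
    · rw [hQ, sigPos_neg_sub_sigNeg_neg', hHI A]
      ring
    · have h := hHR x hx0 hxT hprim
      rw [hB]
      push_cast at h
      linarith

/-- **The Hodge index theorem as printed (Hirzebruch Thm. 15.8.2 / Voisin I Thm. 6.33), Voisin's
spelling**: for `X` smooth projective of dimension `2m` there is an orientation `μ` of `X(ℂ)` (every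
other orientation being `±μ`) whose integral intersection form on `H^{2m}(X(ℂ); ℤ)/T` has signature
`τ(X) = Σ_{a,b ≤ 2m} (-1)^a h^{a,b}(X)`.
[cite: VoisinHodgeI2002, §6.3.2 Thm. 6.33] [cite: Hirzebruch1966, §15.8 Thm. 15.8.2] -/
theorem exists_orientation_signature_intersectionForm_eq (hX : IsSmoothProjective (2 * m) X) {N : ℕ}
    (hN : 2 * (2 * m) = N) (hdeg : 2 * m + 2 * m = N) :
    ∃ μ : HomologicalOrientation ℤ (Motives.ComplexPoints X) N,
      (∀ ν : HomologicalOrientation ℤ (Motives.ComplexPoints X) N, ν = μ ∨ ν = -μ) ∧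
      ∀ A : HodgeModel (2 * m) X,
        (intersectionForm hdeg μ).signature =
          ∑ a : Fin (2 * m + 1), ∑ b : Fin (2 * m + 1),
            (-1 : ℤ) ^ (a : ℕ) * (Module.finrank ℂ (A.hodgePQ ((a : ℕ) + b) a b) : ℤ) := by
  obtain ⟨μ, hall, hsig, -, -⟩ := exists_orientation_hodgeIndex_hodgeRiemann hX hN hdeg
  exact ⟨μ, hall, hsig⟩

/-- **The Hodge index theorem as printed, Hirzebruch's spelling** `τ(X) = Σ_{p,q} (-1)^q h^{p,q}(X)`
for a suitable orientation `μ` of `X(ℂ)` (every other orientation being `±μ`), `X` smooth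
projective of dimension `2m`. [cite: Hirzebruch1966, §15.8 Thm. 15.8.2] [cite: VoisinHodgeI2002, §6.3.2 Thm. 6.33] -/
theorem exists_orientation_signature_intersectionForm_eq' (hX : IsSmoothProjective (2 * m) X) {N : ℕ}
    (hN : 2 * (2 * m) = N) (hdeg : 2 * m + 2 * m = N) :
    ∃ μ : HomologicalOrientation ℤ (Motives.ComplexPoints X) N,
      (∀ ν : HomologicalOrientation ℤ (Motives.ComplexPoints X) N, ν = μ ∨ ν = -μ) ∧
      ∀ A : HodgeModel (2 * m) X,
        (intersectionForm hdeg μ).signature =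
          ∑ p : Fin (2 * m + 1), ∑ q : Fin (2 * m + 1),
            (-1 : ℤ) ^ (q : ℕ) * (Module.finrank ℂ (A.hodgePQ ((p : ℕ) + q) p q) : ℤ) := by
  obtain ⟨μ, hall, hsig⟩ := exists_orientation_signature_intersectionForm_eq hX hN hdeg
  exact ⟨μ, hall, fun A ↦ by rw [hsig A, A.sum_sum_neg_one_pow_fst_eq_snd hX (2 * m)]⟩

/-- **Every orientation gives `±` the Hodge count**: for ANY `ℤ`-orientation `ν` of `X(ℂ)`,
`τ(X(ℂ), ν) = Σ_{a,b} (-1)^a h^{a,b}(X)` or `τ(X(ℂ), ν) = -Σ_{a,b} (-1)^a h^{a,b}(X)`, the second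
case being `ν = -μ` for the positive orientation `μ`. [cite: VoisinHodgeI2002, §6.3.2 Thm. 6.33]
[cite: HatcherAT2002, §3.3 p. 236] -/
theorem signature_intersectionForm_eq_or_eq_neg (hX : IsSmoothProjective (2 * m) X) {N : ℕ}
    (hN : 2 * (2 * m) = N) (ν : HomologicalOrientation ℤ (Motives.ComplexPoints X) N)
    (hdeg : 2 * m + 2 * m = N) (A : HodgeModel (2 * m) X) :
    (intersectionForm hdeg ν).signature =
        ∑ a : Fin (2 * m + 1), ∑ b : Fin (2 * m + 1),
          (-1 : ℤ) ^ (a : ℕ) * (Module.finrank ℂ (A.hodgePQ ((a : ℕ) + b) a b) : ℤ) ∨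
      (intersectionForm hdeg ν).signature =
        -∑ a : Fin (2 * m + 1), ∑ b : Fin (2 * m + 1),
          (-1 : ℤ) ^ (a : ℕ) * (Module.finrank ℂ (A.hodgePQ ((a : ℕ) + b) a b) : ℤ) := by
  obtain ⟨ε, hε, h⟩ := hodgeIndex_intersectionForm_signature hX hN ν hdeg
  rcases hε with rfl | rfl
  · exact Or.inl (by rw [h A, one_mul])
  · exact Or.inr (by rw [h A, neg_one_mul])

end Orientation

end Literature.AlgebraicGeometry.HodgeTheory

end
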